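import Literature.IUT.HodgeTheaters.BadPlaceTMPair
import Literature.AnabelianGeometry.AbsoluteAnabelian.MLFClosureUnitsAnchorProofs
import Literature.AnabelianGeometry.AbsoluteAnabelian.MonoidKummerMapsTLGLiftOpenAugProofs
import Literature.AnabelianGeometry.AbsoluteAnabelian.MonoidKummerMapsMonoAnalyticLiftProofs
import Literature.AnabelianGeometry.AbsoluteAnabelian.MonoidKummerMapsIdRigidProofs
import Literature.IUT.HodgeTheaters.GenuineFKitOfBadLocal
import Literature.IUT.HodgeTheaters.BadLocalGroupDatumOfDoubleUnderline
import HarnessLib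

/-!
# [IUTchI] Cor 5.3 (ii) at `v̲ ∈ V̲^bad`, BY NAME from PROVED rows: `Isom((Π₁ ↷ 𝒪^▷_{K̄₁}), (Π₂ ↷ 𝒪^▷_{K̄₂})) → Isom_{TG}(Π₁, Π₂)` is BIJECTIVE
# at the MLF-Galois `TM`-pairs of bad-place group data (hker ⟸ F-0174, hlift ⟸ F-0409 at open augmentation; proof-only)

S. Mochizuki, *Inter-universal Teichmüller theory I*, kurims manuscript (May 2020), §5 Corollary 5.3 (ii) p. 144 («For `i = 1, 2`, let `ⁱ𝔉`
be an `ℱ`-prime-strip; `ⁱ𝔇` the `𝒟`-prime-strip associated to `ⁱ𝔉` … Then the natural map `Isom(¹𝔉, ²𝔉) → Isom(¹𝔇, ²𝔇)` … is bijective»),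
proof p. 144 l. 33–36 («Assertion (ii) … follows immediately from [AbsTopIII], Proposition 3.2, (iv); [AbsTopIII], Proposition 4.2, (i) [cf.
… Definition 5.2, (vi), (viii)]»); Definition 5.2 (v) p. 135 l. 43–49 (at `v̲ ∈ V̲^non`: «an ind-topological monoid [which is naturally
isomorphic to `𝒪^▷_{F̄_v̲}`] `𝕄_v(‡𝒟_v̲)` equipped with its natural `π₁(‡𝒟_v)`-action» [cf. [AbsTopIII], Corollary 1.10]) and (vi) p. 136
l. 4–17 («`π₁(‡𝒟_v) ↷ ‡𝕄_v` … related to the Frobenioid `‡ℱ_v̲` via the unique isomorphism corresponding to the identity automorphism of `‡𝔇`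
[cf. Corollary 5.3, (ii), below] … the `p_v̲`-adic Frobenioid determined … by the pair `π₁(‡𝒟_v̲) ↷ ‡𝕄_v`»); Example 3.2 (i) p. 70 (`Π_v ↠ G_v`
at `v ∈ V^bad`) ([IUTchI] Cor 5.3 (ii) p.144) [claim: Mochizuki2012, status: disputed] (D-0012 claim key; nothing of the series is asserted; no
side is taken on [IUTchIII] Cor. 3.12; line numbers of the cell's render `lit/IUTchI-DEF52-v-viii-VERBATIM.md`).  S. Mochizuki, *Topics in
absolute anabelian geometry III*, Def. 3.1 (i)/(ii) pp. 66–67, Prop. 3.2 (iv) p. 72 («the natural functor of Definition 3.1, (iii), induces an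
injection `Isom((Π ↷ M_T), (Π* ↷ M*_T)) ↪ Isom_TG(Π, Π*)` … this injection is a bijection» — for `T = TM`, in the author's corrected form,
*Comments* (2019) item (5)) [cite: MochizukiAbsTopIII2015, Proposition 3.2 (iv) p.72].

PROOF-ONLY (theorems only; cell abc-iut, seat abc-iut-w4-d109 gen 10; L5 row «COR53II-BAD-SLOT-BYNAME@TMPAIR» = LANE 2 on token
IUTchI:Cor5.3(ii), keyed by the abc-iut-L5-lead; STEP (A) = abc-iut-L5-t5 gen 8's sizing memo, adopted by the desk).  The sequel of the
def-light adapter `BadPlaceTMPair.lean` (`T.tmPair = (Π_v ↷ 𝒪^▷_{K̄_v})` for a bad-place group datum `T : BadLocalGroupDatum Gal(K̄_v/K_v) Π_v`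
over abc-iut-L5-t16's `GaloisValDatum.ofComplete p K_v`).  WHAT IS PROVED — print's two halves of Cor. 5.3 (ii) at the bad component, read on
the MLF-Galois `TM`-PAIR of Def. 5.2 (v)/(vi) (the carrier on which «[AbsTopIII], Proposition 3.2, (iv)» operates), DISCHARGED AS
FACT-INSTANCES BY NAME of two PROVED rows of abc-iut-L4 (never restated):
* §1 the `.TM` binder (`isMLFGaloisMonoidPair_tmPair`), the arithmetic quotient `T.tmPair.actionKer = Ker(aug)` (`tmPair_actionKer`), and
  «open augmentation» of EVERY `TM`-model of the pair (`isOpenMap_aug_of_iso_tmPair`: along abc-iut-L6's `exists_tlgPair_iso_of_tmPair_iso` +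
  abc-iut-L6-t13's `isOpenMap_aug_of_tlgPair_iso`, from the datum's own `isOpenMap_aug` = print's «the quotient `Π_k ↠ G_k`»);
* §2 INJECTIVITY `hker` ⟸ F-0174 `PairIsoDeterminedByGalois` — `Cor53ii.bad_hker_of_pairIsoDeterminedByGalois (h : PairIsoDeterminedByGalois)`
  and its CLOSED form `Cor53ii.bad_hker` via abc-iut-L6-t13's `pairIsoDeterminedByGalois_holds` (PROVED: Kummer theory + `⋂ₙ (k(x)^×)ⁿ = 1`);
  SURJECTIVITY `hlift` ⟸ F-0409 `GaloisIsoLiftsToTMPairIso H` at the open-augmentation predicate `H` (written inline) —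
  `Cor53ii.bad_hlift_of_galoisIsoLiftsToTMPairIso (h : GaloisIsoLiftsToTMPairIso H)` and its CLOSED form `Cor53ii.bad_hlift` via
  abc-iut-L6-t13's `galoisIsoLiftsToTMPairIso_of_openAug_holds` (PROVED: (BA) `biAnabelianUnits_holds` + `exists_galoisContinuousMulEquiv_of_isOpenMap`);
  and print's word «bijective»: `Cor53ii.bad_tmPairIso_bijective` — `e ↦ e.isoPi : Isom((Π₁ ↷ 𝒪^▷_{K̄₁}), (Π₂ ↷ 𝒪^▷_{K̄₂})) →
  {f : Π₁ ⥲ Π₂ | f(Ker(Π₁ ↠ G₁)) = Ker(Π₂ ↠ G₂)}` is a BIJECTION, for ANY two bad-place group data (any residue characteristics, base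
  fields, topological groups); §3 the kernel form at one pair (`bad_kernel_trivial`, `bad_existsUnique_lift`);
* §4 the same AT THE MERGE TERM — the genuine `TM`-pair `(Π_{X̳̲_v̲} ↷ 𝒪^▷_{K̄_v̲}) = (I.m2 x hx).tmPair` at every bad index `x` of abc-iut-L5's
  genuine `ℱ`-kit inputs `I : D.MergeInputs B` (`GenuineFKitOfBadLocal.lean`; `K_v̲ = K_w`, `p = p_v̲` by the kit's place plumbing);
* §5 the same AT `Π_v̲ := Π^tp_{X̳̲}` of the [EtTh] §1 double-underline curve (abc-iut-L2-t7's junction datum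
  `BadLocalGroupDatum.ofDoubleUnderline dGL hS2 C ι`, any junction `ι : G_K ⥲ Gal(K̄_v/K_v)`; = abc-iut-L5's
  `InitialThetaData.badGroupDatumOfDoubleUnderline` at `K_v := K_w`, definitionally).
BINDER CENSUS of the closed forms: LAW ∅ · FACT ∅ (F-0174, F-0409@open-aug are THEOREMS of the tree) · displayed binder {`hf` : the
Galois isomorphism respects `Ker(Π_v̲ ↠ G_v̲)` — in print supplied by «of hyperbolic orbicurve type» / [AbsTopIII] Thm 1.9 («automorphisms
of `𝒟_v̲` arise from automorphisms of `X̲̲_v̲`»), recorded, NOT proved here} · DATA {T₁, T₂} (resp. {D, B, I, x, hx}, {S, ES, dGL, hS2, C₁, C₂, ι}).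
NOT CLAIMED: the bad-slot laws `CatIsomorphism.RigidOverBase (hull ⋙ toBase)` / `CatIsomorphism.LiftsAll (badStructureFunctor …)` on the
INPUT category `𝒞_v̲ = (I.m1 x hx).Cv` of abc-iut-L5-t2's `TemperedThetaInput` (which carries no monoid / `Π_v̲`-action / valuation:
INPUT-SHAPE label of the L5 desk «the I.m1 hull must expose this `TM`-pair through a Galois-reading faithful functor», under which
abc-iut-w5-d175's `Cor53ii.mapIso_injective_of_readsGalois_of_isTM` books `hker` in `FKit` currency; lane 1 = abc-iut-L5-t4's
`Cor53iiBadSlotKernelAtStandIn` / `Cor53iiBadSlotLiftsAllAtStandIn` at the stand-ins); the token IUTchI:Cor5.3(ii) (L5-lead decides); Cor. 5.3 (ii)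
itself.  HONEST FRAMING: OUR kernel theorems about OUR typed pair; typed ≠ inhabited ≠ proved beyond what is here; nothing asserts that a
bad-place group datum / `MergeInputs` / double-underline curve arises from an actual Tate curve; nothing bears on [IUTchIII] Cor. 3.12;
nothing asserts abc proved or refuted.
-/

noncomputable section

namespace Literature.IUT.HodgeTheaters

open Literature.AnabelianGeometry.AbsoluteAnabelian Literature.AnabelianGeometry.EtaleTheta

/-! ### §1. The `TM`-pair `(Π_v ↷ 𝒪^▷_{K̄_v})` is MLF-Galois, its arithmetic quotient is `Π_v ↠ G_v`, and every `TM`-model of it has open `ε` -/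

namespace BadLocalGroupDatum

variable {p : ℕ} [Fact p.Prime] {k : Type} [NontriviallyNormedField k] [CompleteSpace k] [IsUltrametricDist k]
  [NormedAlgebra ℚ_[p] k] [FiniteDimensional ℚ_[p] k]
  {P : Type} [Group P] [TopologicalSpace P] [IsTopologicalGroup P]
  (T : BadLocalGroupDatum (GaloisValDatum.ofComplete p k).Gal P)

/-- **The `.TM` binder DISCHARGED**: `(Π_v ↷ 𝒪^▷_{K̄_v})` IS an MLF-Galois `TM`-pair ([AbsTopIII] Def 3.1 (ii)) — abc-iut-L4-t2's
`isMLFGaloisMonoidPair_tmPair` at `T.modelData` (identity isomorphism with the model pair).  This is the hypothesis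
`IsMLFGaloisMonoidPair .TM` of the frozen facts F-0174 `PairIsoDeterminedByGalois` and F-0409 `GaloisIsoLiftsToTMPairIso`.
[cite: MochizukiAbsTopIII2015, Definition 3.1 (ii) p.67] -/
theorem isMLFGaloisMonoidPair_tmPair : IsMLFGaloisMonoidPair .TM T.tmPair :=
  Literature.AnabelianGeometry.AbsoluteAnabelian.isMLFGaloisMonoidPair_tmPair _ _

/-- **The arithmetic quotient of the pair is `Π_v ↠ G_v`**: the kernel of the action of `Π_v` on `𝒪^▷_{K̄_v}` ([AbsTopIII] Def 3.1 (ii) «the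
quotient `Π ↠ G` determined by the action of `Π` on `M`», abc-iut-L4-t2's `GaloisMonoidPair.actionKer`) IS `Ker(aug)` (`Gal(K̄_v/K_v)` acts
faithfully on `𝒪^▷_{K̄_v}`; abc-iut-L6's `ModelMLFGaloisData.tmPair_actionKer`). [cite: MochizukiAbsTopIII2015, Definition 3.1 (ii) p.67] -/
theorem tmPair_actionKer : T.tmPair.actionKer = T.aug.ker :=
  ModelMLFGaloisData.tmPair_actionKer (GaloisValDatum.closureOfComplete p k) T.modelData

/-- **Every [AbsTopIII] Def 3.1 (i) model `(k', k̄', ε' : Π' ↠ G_{k'})` whose `TM`-pair is isomorphic to `(Π_v ↷ 𝒪^▷_{K̄_v})` has OPEN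
augmentation** — «open augmentation» (print's «the quotient `Π_k ↠ G_k`») is a property of the `TM`-PAIR: an isomorphism of model
`TM`-pairs extends to the `TLG`-pairs (abc-iut-L6's `ModelMLFGaloisData.exists_tlgPair_iso_of_tmPair_iso`, `β(a/b) := β(a)/β(b)`), and
along an isomorphism of model `TLG`-pairs openness of `ε` transfers (abc-iut-L6-t13's `ModelMLFGaloisData.isOpenMap_aug_of_tlgPair_iso`);
the source model `T.modelData` has open `ε = aug` ([IUTchI] Ex 3.2 (i): the datum's `isOpenMap_aug` — print's «the quotient `Π_k ↠ G_k`»).  This is EXACTLY the hypothesis `hH`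
of abc-iut-L6-t13's `galoisIsoLiftsToTMPairIso_of_openAug_holds` at the pair. [cite: MochizukiAbsTopIII2015, Definition 3.1 (ii) p.67] -/
theorem isOpenMap_aug_of_iso_tmPair (C : MLFClosure.{0}) (D : ModelMLFGaloisData C.k C.K)
    (h : Nonempty (GaloisMonoidPair.Iso D.tmPair T.tmPair)) : IsOpenMap D.aug := by
  obtain ⟨ι⟩ := h
  obtain ⟨e, -⟩ := ModelMLFGaloisData.exists_tlgPair_iso_of_tmPair_iso T.modelData D ι.symm'
  exact ModelMLFGaloisData.isOpenMap_aug_of_tlgPair_iso T.modelData D e T.isOpenMap_aug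

/-- The pair `(Π_v ↷ 𝒪^▷_{K̄_v})` satisfies the OPEN-AUGMENTATION hypothesis predicate of F-0409 (written inline: «every `TM`-model of the
pair has open augmentation»). [cite: MochizukiAbsTopIII2015, Definition 3.1 (ii) p.67] -/
theorem tmPair_openAug :
    (fun Q : GaloisMonoidPair.{0} => ∀ (C : MLFClosure.{0}) (D : ModelMLFGaloisData C.k C.K),
      Nonempty (GaloisMonoidPair.Iso D.tmPair Q) → IsOpenMap D.aug) T.tmPair :=
  fun C D h => T.isOpenMap_aug_of_iso_tmPair C D h

end BadLocalGroupDatum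

/-! ### §2. Cor 5.3 (ii) at the `TM`-pairs of two bad-place group data: INJECTIVITY (hker ⟸ F-0174), SURJECTIVITY (hlift ⟸ F-0409), BIJECTIVITY -/

namespace Cor53ii

variable {p₁ p₂ : ℕ} [Fact p₁.Prime] [Fact p₂.Prime]
  {k₁ : Type} [NontriviallyNormedField k₁] [CompleteSpace k₁] [IsUltrametricDist k₁] [NormedAlgebra ℚ_[p₁] k₁] [FiniteDimensional ℚ_[p₁] k₁]
  {k₂ : Type} [NontriviallyNormedField k₂] [CompleteSpace k₂] [IsUltrametricDist k₂] [NormedAlgebra ℚ_[p₂] k₂] [FiniteDimensional ℚ_[p₂] k₂]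
  {P₁ : Type} [Group P₁] [TopologicalSpace P₁] [IsTopologicalGroup P₁]
  {P₂ : Type} [Group P₂] [TopologicalSpace P₂] [IsTopologicalGroup P₂]
  (T₁ : BadLocalGroupDatum (GaloisValDatum.ofComplete p₁ k₁).Gal P₁) (T₂ : BadLocalGroupDatum (GaloisValDatum.ofComplete p₂ k₂).Gal P₂)

/-- **Cor 5.3 (ii), INJECTIVITY half at the bad-place `TM`-pairs, modulo F-0174 BY NAME** (`hker ⟸ PairIsoDeterminedByGalois`, [AbsTopIII]
Prop 3.2 (iv) «induces an injection `Isom((Π ↷ M_TM), (Π* ↷ M*_TM)) ↪ Isom_TG(Π, Π*)`»): two isomorphisms `(Π₁ ↷ 𝒪^▷_{K̄₁}) ⥲ (Π₂ ↷ 𝒪^▷_{K̄₂})`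
with the same Galois component `Π₁ ⥲ Π₂` coincide.  The `.TM` binders of F-0174 are DISCHARGED (`isMLFGaloisMonoidPair_tmPair`); the FACT is
the displayed hypothesis `h`. ([IUTchI] Cor 5.3 (ii) p.144) [claim: Mochizuki2012, status: disputed] -/
theorem bad_hker_of_pairIsoDeterminedByGalois (h : PairIsoDeterminedByGalois)
    (e₁ e₂ : GaloisMonoidPair.Iso T₁.tmPair T₂.tmPair) (hPi : e₁.isoPi = e₂.isoPi) : e₁.isoM = e₂.isoM :=
  h _ _ T₁.isMLFGaloisMonoidPair_tmPair T₂.isMLFGaloisMonoidPair_tmPair e₁ e₂ hPi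

/-- **Cor 5.3 (ii), INJECTIVITY half at the bad-place `TM`-pairs — FACT-FREE** (F-0174 is PROVED in the tree: abc-iut-L6-t13's
`pairIsoDeterminedByGalois_holds`, Kummer theory + `⋂ₙ (k(x)^×)ⁿ = 1`): `hker` at `(Π_v̲ ↷ 𝒪^▷_{K̄_v̲})` HOLDS.  LAW ∅ · FACT ∅.
([IUTchI] Cor 5.3 (ii) p.144) [claim: Mochizuki2012, status: disputed] -/
theorem bad_hker (e₁ e₂ : GaloisMonoidPair.Iso T₁.tmPair T₂.tmPair) (hPi : e₁.isoPi = e₂.isoPi) : e₁.isoM = e₂.isoM :=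
  bad_hker_of_pairIsoDeterminedByGalois T₁ T₂ pairIsoDeterminedByGalois_holds e₁ e₂ hPi

/-- **Cor 5.3 (ii), SURJECTIVITY half at the bad-place `TM`-pairs, modulo F-0409 BY NAME at the open-augmentation predicate** (`hlift ⟸
GaloisIsoLiftsToTMPairIso H`, [AbsTopIII] Prop 3.2 (iv) as corrected «this injection is a bijection», `H :=` «every `TM`-model has open
augmentation» — print's «the quotient `Π_k ↠ G_k`»): every isomorphism of topological groups `f : Π₁ ⥲ Π₂` carrying `Ker(Π₁ ↠ G₁)` onto
`Ker(Π₂ ↠ G₂)` («an isomorphism of `𝒯𝒢`») lifts to an isomorphism of pairs `(Π₁ ↷ 𝒪^▷_{K̄₁}) ⥲ (Π₂ ↷ 𝒪^▷_{K̄₂})`.  The `.TM` binders and the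
predicate instances `H (Πᵢ ↷ 𝒪^▷)` are DISCHARGED (`isMLFGaloisMonoidPair_tmPair`, `tmPair_openAug`); F-0409's own quotient-compatibility
binder `hf` is DISPLAYED (in print it is what «of hyperbolic orbicurve type» / [AbsTopIII] Thm 1.9 supplies: automorphisms of `𝒟_v̲`
arise from automorphisms of `X̲̲_v̲`, hence respect `Ker(Π_v̲ ↠ G_v̲)` — recorded, not proved here).
([IUTchI] Cor 5.3 (ii) p.144) [claim: Mochizuki2012, status: disputed] -/
theorem bad_hlift_of_galoisIsoLiftsToTMPairIso
    (h : GaloisIsoLiftsToTMPairIso fun Q : GaloisMonoidPair.{0} => ∀ (C : MLFClosure.{0}) (D : ModelMLFGaloisData C.k C.K),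
      Nonempty (GaloisMonoidPair.Iso D.tmPair Q) → IsOpenMap D.aug)
    (f : P₁ ≃ₜ* P₂) (hf : T₁.aug.ker.map f.toMulEquiv.toMonoidHom = T₂.aug.ker) :
    ∃ e : GaloisMonoidPair.Iso T₁.tmPair T₂.tmPair, e.isoPi = f :=
  h _ _ T₁.isMLFGaloisMonoidPair_tmPair T₂.isMLFGaloisMonoidPair_tmPair T₁.tmPair_openAug T₂.tmPair_openAug f
    (by rw [T₁.tmPair_actionKer, T₂.tmPair_actionKer]; exact hf)

/-- **Cor 5.3 (ii), SURJECTIVITY half at the bad-place `TM`-pairs — FACT-FREE** (F-0409 at open augmentation is PROVED in the tree: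
abc-iut-L6-t13's `galoisIsoLiftsToTMPairIso_of_openAug_holds` = (BA) `biAnabelianUnits_holds` + `exists_galoisContinuousMulEquiv_of_isOpenMap`):
every `Ker`-compatible `f : Π₁ ⥲ Π₂` lifts to `(Π₁ ↷ 𝒪^▷_{K̄₁}) ⥲ (Π₂ ↷ 𝒪^▷_{K̄₂})`.  LAW ∅ · FACT ∅ · displayed binder {hf}.
([IUTchI] Cor 5.3 (ii) p.144) [claim: Mochizuki2012, status: disputed] -/
theorem bad_hlift (f : P₁ ≃ₜ* P₂) (hf : T₁.aug.ker.map f.toMulEquiv.toMonoidHom = T₂.aug.ker) :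
    ∃ e : GaloisMonoidPair.Iso T₁.tmPair T₂.tmPair, e.isoPi = f :=
  bad_hlift_of_galoisIsoLiftsToTMPairIso T₁ T₂ (galoisIsoLiftsToTMPairIso_of_openAug_holds _ fun _ hQ => hQ) f hf

/-- The Galois component of an isomorphism of the pairs carries `Ker(Π₁ ↠ G₁)` onto `Ker(Π₂ ↠ G₂)` (it «respects the arithmetic quotients»;
abc-iut-L6's `GaloisMonoidPair.Iso.map_actionKer` + `tmPair_actionKer`). [cite: MochizukiAbsTopIII2015, Definition 3.1 (ii) p.67] -/
theorem bad_isoPi_map_ker (e : GaloisMonoidPair.Iso T₁.tmPair T₂.tmPair) :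
    T₁.aug.ker.map e.isoPi.toMulEquiv.toMonoidHom = T₂.aug.ker := by
  rw [← T₁.tmPair_actionKer, ← T₂.tmPair_actionKer]; exact e.map_actionKer

/-- **[IUTchI] Cor 5.3 (ii) AS PRINTED («bijective») at the `TM`-pairs of two bad-place group data — FACT-FREE**: the natural map
`Isom((Π₁ ↷ 𝒪^▷_{K̄₁}), (Π₂ ↷ 𝒪^▷_{K̄₂})) → Isom_{TG}(Π₁, Π₂)`, `e ↦ e.isoPi`, onto the isomorphisms of topological groups carrying `Ker(Π₁ ↠ G₁)`
onto `Ker(Π₂ ↠ G₂)`, is a BIJECTION (injective = `bad_hker` ⟸ F-0174 PROVED; surjective = `bad_hlift` ⟸ F-0409@open-aug PROVED).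
Binder census: LAW ∅ · FACT ∅ · DATA {T₁, T₂}. ([IUTchI] Cor 5.3 (ii) p.144) [claim: Mochizuki2012, status: disputed] -/
theorem bad_tmPairIso_bijective :
    Function.Bijective (fun e : GaloisMonoidPair.Iso T₁.tmPair T₂.tmPair =>
      (⟨e.isoPi, bad_isoPi_map_ker T₁ T₂ e⟩ : {f : P₁ ≃ₜ* P₂ // T₁.aug.ker.map f.toMulEquiv.toMonoidHom = T₂.aug.ker})) := by
  constructor
  · intro e₁ e₂ h
    have hPi : e₁.isoPi = e₂.isoPi := congrArg Subtype.val h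
    have hM : e₁.isoM = e₂.isoM := bad_hker T₁ T₂ e₁ e₂ hPi
    cases e₁
    cases e₂
    simp only at hPi hM
    subst hPi hM
    rfl
  · rintro ⟨f, hf⟩
    obtain ⟨e, he⟩ := bad_hlift T₁ T₂ f hf
    exact ⟨e, Subtype.ext he⟩

end Cor53ii

/-! ### §3. The kernel form at ONE bad-place pair: an automorphism of `(Π_v ↷ 𝒪^▷_{K̄_v})` over `id_{Π_v}` is the identity -/

namespace Cor53ii

variable {p : ℕ} [Fact p.Prime] {k : Type} [NontriviallyNormedField k] [CompleteSpace k] [IsUltrametricDist k]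
  [NormedAlgebra ℚ_[p] k] [FiniteDimensional ℚ_[p] k]
  {P : Type} [Group P] [TopologicalSpace P] [IsTopologicalGroup P]
  (T : BadLocalGroupDatum (GaloisValDatum.ofComplete p k).Gal P)

/-- **Kernel triviality at `(Π_v̲ ↷ 𝒪^▷_{K̄_v̲})`** (print's injectivity argument, p. 144 «let `α ∈ Ker` … lies over the identity … `α` is the
identity»): an automorphism of the pair whose Galois component is `id_{Π_v}` acts as the identity on `𝒪^▷_{K̄_v}`.  FACT-FREE.
([IUTchI] Cor 5.3 (ii) p.144) [claim: Mochizuki2012, status: disputed] -/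
theorem bad_kernel_trivial (e : GaloisMonoidPair.Iso T.tmPair T.tmPair) (hPi : e.isoPi = ContinuousMulEquiv.refl P) :
    e.isoM = MulEquiv.refl T.tmPair.M :=
  bad_hker T T e (GaloisMonoidPair.Iso.refl T.tmPair) hPi

/-- **Every `Ker(aug)`-preserving topological automorphism of `Π_v` lifts UNIQUELY to an automorphism of `(Π_v̲ ↷ 𝒪^▷_{K̄_v̲})`**
(bijectivity of `Aut((Π_v ↷ 𝒪^▷_{K̄_v})) → Aut_{TG}(Π_v)`, the `¹𝔉 = ²𝔉` case of Cor 5.3 (ii)).  FACT-FREE.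
([IUTchI] Cor 5.3 (ii) p.144) [claim: Mochizuki2012, status: disputed] -/
theorem bad_existsUnique_lift (f : P ≃ₜ* P) (hf : T.aug.ker.map f.toMulEquiv.toMonoidHom = T.aug.ker) :
    ∃! m : T.tmPair.M ≃* T.tmPair.M, ∃ e : GaloisMonoidPair.Iso T.tmPair T.tmPair, e.isoPi = f ∧ e.isoM = m := by
  obtain ⟨e, he⟩ := bad_hlift T T f hf
  refine ⟨e.isoM, ⟨e, he, rfl⟩, ?_⟩
  rintro m ⟨e', he', rfl⟩
  exact bad_hker T T e' e (he'.trans he.symm)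

end Cor53ii

/-! ### §4. AT THE MERGE TERM: the genuine `TM`-pair `(Π_{X̳̲_v̲} ↷ 𝒪^▷_{K̄_v̲})` of `I.m2 x hx` at every bad index of the genuine `ℱ`-kit -/

namespace Cor53ii

open _root_.NumberField _root_.IsDedekindDomain

variable {F K Fbar : Type} [Field F] [NumberField F] [Field K] [NumberField K] [Algebra F K]
  [Field Fbar] [Algebra F Fbar] [Algebra K Fbar] {E : WeierstrassCurve F} [E.IsElliptic] {l : ℕ} {Pb : BadPlacePredicates K}
  (D : InitialThetaData F K Fbar E l Pb) (B : ∀ v, v ∈ D.indexCopyBad → D.BadPairAt v) (I : D.MergeInputs B)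

/-- **Cor 5.3 (ii) INJECTIVITY (hker) AT THE MERGE TERM, FACT-FREE**: at every bad index `x` of the genuine `ℱ`-kit (abc-iut-L5's
`InitialThetaData.MergeInputs`, hub object (m2) = the [IUTchI] Ex 3.2 (i) group datum `I.m2 x hx : BadLocalGroupDatum Gal(K̄_w/K_w) Π_{X̳̲_v̲}`
on the kit's own local group `(B x hx).H`, over `D.gvdAt x = GaloisValDatum.ofPlace K p_v̲ w _`), two automorphisms of the genuine `TM`-pair
`(Π_{X̳̲_v̲} ↷ 𝒪^▷_{K̄_v̲}) = (I.m2 x hx).tmPair` with the same Galois component coincide (§2 `bad_hker` ⟸ F-0174 PROVED).  The two `haveI` lines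
only install the place's `Fact p_v̲.Prime` / `[K_v̲ : ℚ_{p_v̲}] < ∞` (theorems `fact_primeAt_prime`, `finiteDimensional_rescaledCompletion`).
([IUTchI] Cor 5.3 (ii) p.144) [claim: Mochizuki2012, status: disputed] -/
theorem mergeInputs_bad_hker (x : D.IndexCopy) (hx : x ∈ D.indexCopyBad) :
    haveI := D.fact_primeAt_prime x (D.not_mem_arc_of_mem_bad hx)
    haveI := GaloisValDatum.finiteDimensional_rescaledCompletion K (D.primeAt x (D.not_mem_arc_of_mem_bad hx))
      (D.specAt x (D.not_mem_arc_of_mem_bad hx)) (D.primeAt_mem x (D.not_mem_arc_of_mem_bad hx))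
    ∀ e₁ e₂ : GaloisMonoidPair.Iso (I.m2 x hx).tmPair (I.m2 x hx).tmPair, e₁.isoPi = e₂.isoPi → e₁.isoM = e₂.isoM := by
  haveI := D.fact_primeAt_prime x (D.not_mem_arc_of_mem_bad hx)
  haveI := GaloisValDatum.finiteDimensional_rescaledCompletion K (D.primeAt x (D.not_mem_arc_of_mem_bad hx))
    (D.specAt x (D.not_mem_arc_of_mem_bad hx)) (D.primeAt_mem x (D.not_mem_arc_of_mem_bad hx))
  exact fun e₁ e₂ h => bad_hker _ _ e₁ e₂ h

/-- **Cor 5.3 (ii) SURJECTIVITY (hlift) AT THE MERGE TERM, FACT-FREE**: at every bad index, every topological automorphism `f` of the kit's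
local group `Π_{X̳̲_v̲} = (B x hx).H` carrying `Ker(Π_{X̳̲_v̲} ↠ G_v̲)` onto itself lifts to an automorphism of `(Π_{X̳̲_v̲} ↷ 𝒪^▷_{K̄_v̲})` (§2 `bad_hlift` ⟸
F-0409@open-aug PROVED; displayed binder {hf}). ([IUTchI] Cor 5.3 (ii) p.144) [claim: Mochizuki2012, status: disputed] -/
theorem mergeInputs_bad_hlift (x : D.IndexCopy) (hx : x ∈ D.indexCopyBad) :
    haveI := D.fact_primeAt_prime x (D.not_mem_arc_of_mem_bad hx)
    haveI := GaloisValDatum.finiteDimensional_rescaledCompletion K (D.primeAt x (D.not_mem_arc_of_mem_bad hx))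
      (D.specAt x (D.not_mem_arc_of_mem_bad hx)) (D.primeAt_mem x (D.not_mem_arc_of_mem_bad hx))
    ∀ f : ↥(B x hx).H ≃ₜ* ↥(B x hx).H, (I.m2 x hx).aug.ker.map f.toMulEquiv.toMonoidHom = (I.m2 x hx).aug.ker →
      ∃ e : GaloisMonoidPair.Iso (I.m2 x hx).tmPair (I.m2 x hx).tmPair, e.isoPi = f := by
  haveI := D.fact_primeAt_prime x (D.not_mem_arc_of_mem_bad hx)
  haveI := GaloisValDatum.finiteDimensional_rescaledCompletion K (D.primeAt x (D.not_mem_arc_of_mem_bad hx))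
    (D.specAt x (D.not_mem_arc_of_mem_bad hx)) (D.primeAt_mem x (D.not_mem_arc_of_mem_bad hx))
  exact fun f hf => bad_hlift _ _ f hf

/-- **[IUTchI] Cor 5.3 (ii) AS PRINTED («bijective») AT THE MERGE TERM, FACT-FREE**: at every bad index `x` of the genuine `ℱ`-kit,
`Aut((Π_{X̳̲_v̲} ↷ 𝒪^▷_{K̄_v̲})) → {f ∈ Aut_{top}(Π_{X̳̲_v̲}) | f(Ker aug) = Ker aug}`, `e ↦ e.isoPi`, is a BIJECTION (§2 `bad_tmPairIso_bijective`).
Binder census: LAW ∅ · FACT ∅ · DATA {D, B, I, x, hx}.  NOT claimed: the bad-slot laws `RigidOverBase (hull ⋙ toBase)` /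
`LiftsAll (badStructureFunctor …)` on the INPUT category `(I.m1 x hx).Cv` (INPUT-SHAPE label of the L5 desk: the hull must expose this `TM`-pair
through a Galois-reading faithful functor — abc-iut-L5-t5 gen 8 sizing memo §1; lane 1 = abc-iut-L5-t4's `Cor53iiBadSlot*AtStandIn`).
([IUTchI] Cor 5.3 (ii) p.144) [claim: Mochizuki2012, status: disputed] -/
theorem mergeInputs_bad_tmPairIso_bijective (x : D.IndexCopy) (hx : x ∈ D.indexCopyBad) :
    haveI := D.fact_primeAt_prime x (D.not_mem_arc_of_mem_bad hx)
    haveI := GaloisValDatum.finiteDimensional_rescaledCompletion K (D.primeAt x (D.not_mem_arc_of_mem_bad hx))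
      (D.specAt x (D.not_mem_arc_of_mem_bad hx)) (D.primeAt_mem x (D.not_mem_arc_of_mem_bad hx))
    Function.Bijective (fun e : GaloisMonoidPair.Iso (I.m2 x hx).tmPair (I.m2 x hx).tmPair =>
      (⟨e.isoPi, bad_isoPi_map_ker (I.m2 x hx) (I.m2 x hx) e⟩ :
        {f : ↥(B x hx).H ≃ₜ* ↥(B x hx).H // (I.m2 x hx).aug.ker.map f.toMulEquiv.toMonoidHom = (I.m2 x hx).aug.ker})) := by
  haveI := D.fact_primeAt_prime x (D.not_mem_arc_of_mem_bad hx)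
  haveI := GaloisValDatum.finiteDimensional_rescaledCompletion K (D.primeAt x (D.not_mem_arc_of_mem_bad hx))
    (D.specAt x (D.not_mem_arc_of_mem_bad hx)) (D.primeAt_mem x (D.not_mem_arc_of_mem_bad hx))
  exact bad_tmPairIso_bijective _ _

end Cor53ii

/-! ### §5. AT `Π_v̲ := Π^tp_{X̳̲}` of the [EtTh] §1 double-underline curve (abc-iut-L2-t7's junction datum `BadLocalGroupDatum.ofDoubleUnderline`) -/

namespace Cor53ii

variable {p : ℕ} [Fact p.Prime] {k : Type} [NontriviallyNormedField k] [CompleteSpace k] [IsUltrametricDist k]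
  [NormedAlgebra ℚ_[p] k] [FiniteDimensional ℚ_[p] k]
  {S : ThetaSetting p} {ES : S.EtaleThetaData} {l : ℕ}
  (dGL : S.toTemperedCurve.GroupLevelData) (hS2 : S.Sec2Hyps) (C₁ C₂ : ES.DoubleUnderline l)
  (ι : ↥S.GK ≃ₜ* (GaloisValDatum.ofComplete p k).Gal)

/-- **[IUTchI] Cor 5.3 (ii) AS PRINTED («bijective») AT THE TEMPERED FUNDAMENTAL GROUPS `Π^tp_{X̳̲}`, FACT-FREE**: for the [EtTh] §1 setting
`S` (residue characteristic `p`), étale theta data `ES`, group-level data `dGL`, `Sec2Hyps`, two double-underline curves `C₁`, `C₂` and ANY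
junction `ι : G_K ⥲ Gal(K̄_v/K_v)` with the valued Galois datum of a complete `K_v` (abc-iut-L2-t7's `BadLocalGroupDatum.ofDoubleUnderline`;
at `K_v := K_w` this is abc-iut-L5's `InitialThetaData.badGroupDatumOfDoubleUnderline`, definitionally), the natural map
`Isom((Π^tp_{X̳̲₁} ↷ 𝒪^▷_{K̄_v}), (Π^tp_{X̳̲₂} ↷ 𝒪^▷_{K̄_v})) → Isom_{TG}(Π^tp_{X̳̲₁}, Π^tp_{X̳̲₂})` is a BIJECTION (§2).  Binder census: LAW ∅ · FACT ∅ ·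
DATA {S, ES, dGL, hS2, C₁, C₂, ι}. ([IUTchI] Cor 5.3 (ii) p.144) [claim: Mochizuki2012, status: disputed] -/
theorem ofDoubleUnderline_bad_tmPairIso_bijective :
    Function.Bijective (fun e : GaloisMonoidPair.Iso (BadLocalGroupDatum.ofDoubleUnderline dGL hS2 C₁ ι).tmPair
        (BadLocalGroupDatum.ofDoubleUnderline dGL hS2 C₂ ι).tmPair =>
      (⟨e.isoPi, bad_isoPi_map_ker _ _ e⟩ : {f : ↥C₁.Huu ≃ₜ* ↥C₂.Huu //
        (BadLocalGroupDatum.ofDoubleUnderline dGL hS2 C₁ ι).aug.ker.map f.toMulEquiv.toMonoidHom =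
          (BadLocalGroupDatum.ofDoubleUnderline dGL hS2 C₂ ι).aug.ker})) :=
  bad_tmPairIso_bijective _ _

/-- **hker at `Π^tp_{X̳̲}`, FACT-FREE** (§2 `bad_hker` ⟸ F-0174 PROVED). ([IUTchI] Cor 5.3 (ii) p.144) [claim: Mochizuki2012, status: disputed] -/
theorem ofDoubleUnderline_bad_hker
    (e₁ e₂ : GaloisMonoidPair.Iso (BadLocalGroupDatum.ofDoubleUnderline dGL hS2 C₁ ι).tmPair
      (BadLocalGroupDatum.ofDoubleUnderline dGL hS2 C₂ ι).tmPair) (hPi : e₁.isoPi = e₂.isoPi) : e₁.isoM = e₂.isoM :=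
  bad_hker _ _ e₁ e₂ hPi

/-- **hlift at `Π^tp_{X̳̲}`, FACT-FREE** (§2 `bad_hlift` ⟸ F-0409@open-aug PROVED; displayed binder {hf}).
([IUTchI] Cor 5.3 (ii) p.144) [claim: Mochizuki2012, status: disputed] -/
theorem ofDoubleUnderline_bad_hlift (f : ↥C₁.Huu ≃ₜ* ↥C₂.Huu)
    (hf : (BadLocalGroupDatum.ofDoubleUnderline dGL hS2 C₁ ι).aug.ker.map f.toMulEquiv.toMonoidHom =
      (BadLocalGroupDatum.ofDoubleUnderline dGL hS2 C₂ ι).aug.ker) :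
    ∃ e : GaloisMonoidPair.Iso (BadLocalGroupDatum.ofDoubleUnderline dGL hS2 C₁ ι).tmPair
      (BadLocalGroupDatum.ofDoubleUnderline dGL hS2 C₂ ι).tmPair, e.isoPi = f :=
  bad_hlift _ _ f hf

end Cor53ii

end Literature.IUT.HodgeTheaters

end
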